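import Mathlib.Analysis.Analytic.Constructions
import Mathlib.Analysis.SpecialFunctions.Log.Basic
import Literature.MathematicalPhysics.QuantumLattice.HubbardModel
import HarnessLib

/-!
# Barrier: the strong-coupling / high-temperature (cluster-expansion) ceiling `βt < ε`

Barrier catalogue `Literature/Barriers/HubbardSuperconductivity/` (D-0021), entry
`StrongCouplingCeiling`; with `WeakCouplingCeiling.lean` it renders the seed barrier "lack of
controlled expansions at intermediate `U`" for the summit `HubbardSuperconductivity`
(`d_{x²-y²}` pair-field long-range order in the *ground states* of the doped repulsive 2D
Hubbard model). This file is the large-`U` / small-`βt` side: what convergent expansions around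
the atomic limit `t = 0` (equivalently high temperature on the hopping scale) prove, and where the
sources say they stop.

## What is vendored (as printed)

* D. Ueltschi, *Analyticity in Hubbard models*, J. Stat. Phys. **95** (1999) 693–717
  (`Ueltschi1999`, held as `paper:arxiv-cond-mat_9810320`). Theorem 2.1 (models
  `H^μ = V^μ + T^μ`, `V^μ` on-site, `T^μ` a finite-range quantum interaction, free boundary
  conditions on finite `Λ ⊂ 𝕃`, thermodynamic limit along van Hove sequences): in the domain
  `β ‖T^μ‖_c < 1` — which "does not depend on the local interaction `V`" — (i) the free energy
  exists in the thermodynamic limit and is analytic in `β` and `μ`; (ii) the Gibbs state converges;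
  (iii) it is exponentially clustering; (iv)–(v) it is stable against small boundary interactions
  and external perturbations (uniqueness), in particular against the `U(1)`-breaking boundary
  terms `Σ (e^{-iθ} c†_{x↑} c†_{y↓} + h.c.)` that would reveal superconductivity (§2.2).
  Theorem 3.1 (Hubbard model `-t Σ_{⟨x,y⟩,σ} c†c + U Σ n↑n↓ - μ N` on a lattice with maximal
  coordination number `χ`): the same conclusions in `D₁ ∪ D₂`, `D₁ = {βt < ε}` (explicitly
  `βt < 1.75·10⁻⁴` for the cubic lattice), `D₂ = {β t²/Δ small}` with `Δ = min(μ, U - μ)` (near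
  half filling, temperature above the exchange scale `t²/U`); §1: "interesting phenomena are
  definitively excluded for some values of the thermodynamic parameters"; §3: an antiferromagnetic
  phase at `βt²/U > const` "can be proven in the asymmetric Hubbard model".
* N. Datta, R. Fernández, J. Fröhlich, *Effective Hamiltonians and phase diagrams for
  tight-binding models*, J. Stat. Phys. **96** (1999) 545–611 (`DattaFernandezFrohlich1999`,
  held as `paper:arxiv-math-ph_9809007`): convergent unitary-conjugation ("`t/U`") expansions
  giving the Heisenberg / `t`-`J` effective interactions to any finite order with full control
  (§1.2 (I)), and low-temperature phase diagrams by quantum Pirogov–Sinai theory (§1.2 (II)) —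
  "rigorous control of the ground states and low-temperature equilibrium states on the
  'unperturbed' coexistence line `μ₊ = μ₋` with the help of contour expansions will be achieved
  only for the models without continuous `SU(2)`-symmetry" (§1.2, p. 6); "Our methods are not
  suited for the study of the phase diagram of the `SU(2)`-symmetric Hubbard model, because
  continuous symmetry breaking is accompanied by the appearance of gapless modes" (§1.2, p. 7);
  §4 (p. 21): "when there is a continuous symmetry, states are usually grouped in bands with
  gapless intraband excitations. An arbitrarily small additional term can split the lower bands
  and hence change the phase diagram. Such models are hard to treat rigorously; in particular, no
  such treatment is available for the (symmetric) Hubbard model, despite our control on the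
  perturbation series"; §1.2 p. 5: on `0 < μ₊ = μ₋ < U` "the ground state is infinitely
  degenerate, because all singly occupied configurations are equally likely".
* H. Tasaki, *The Hubbard model — an introduction and selected rigorous results*, J. Phys. Cond.
  Matt. **10** (1998) 4353 (`Tasaki1998`, held as `paper:arxiv-cond-mat_9512169`), §5.1 (ground
  states of the non-hopping model = all spin configurations; second-order perturbation gives the
  `S = 1/2` Heisenberg antiferromagnet with `J_{xy} = 2t²/U`, eq. (5.2)) and §5.2 ("It is likely
  that the same statements [antiferromagnetic LRO] hold for the half-filled Hubbard model with
  sufficiently large `U`. But, for the moment, there are no methods or ideas which are useful in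
  proving the conjecture. To extend the … method … based on the (spatial) reflection positivity
  seems hopeless.").
* Arovas–Berg–Kivelson–Raghu 2022 §5.2 (p. 17): "the existence of ferromagnetic phases at very
  large `U` implies that, strictly speaking, the non-ferromagnetic states generally seen (and
  expected) at intermediate values of `U` cannot be approached from a strong-coupling perspective."

Lean rendering. The headline `StrongCouplingCeiling` is Ueltschi's Theorem 3.1 (which has no
numbered parts; "(i)" below always refers to part (i) of Theorem 2.1, which Theorem 3.1 invokes) on
the domain `D₁`, for the square lattice `ℤ²` in the tree's own objects: the grand-canonical
Hubbard Hamiltonian `Literature.QLattice.hamiltonianWith (fermionBoxGraph 2 L) t U μ` on the boxes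
`{-L,…,L}²` with FREE boundary conditions (`Literature.MathematicalPhysics.QuantumLattice.FermionBox`, exactly Ueltschi's `H_Λ`),
the finite-volume free energy `boxFreeEnergy t U μ β L = -(β|Λ_L|)⁻¹ log tr e^{-β(H - μN)}`
(`Matrix.partitionFn`), its limit `freeEnergy` (`limUnder`, junk if divergent), and the
statement: `∃ ε > 0` (Ueltschi's explicit `ε(χ)` is not transcribed) such that for `t, U ≥ 0`,
`β > 0`, `βt < ε` and every `μ` the limit exists and is JOINTLY real-analytic in `(β, μ)`
(`AnalyticAt ℝ` on `ℝ × ℝ` at `(β, μ)`; "analytic in `β` and `μ`"). Joint analyticity in the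
hopping `t` as well (which Thm 2.1 yields, `T^μ` depending linearly on `t`) is not transcribed.
Parts (ii)–(v) (clustering, uniqueness, absence of superconducting response) and the domain
`D₂` are cited in the BARRIER block, not restated (they need infinite-volume fermionic states).

## Mathlib / tree search

Mathlib: `AnalyticAt`, `limUnder`, `Real.log`; nothing on lattice free energies. Tree:
`Matrix.partitionFn`, `Matrix.gibbsState` (`FinDimSpectrum.lean`), `hamiltonianWith`,
`FermionBox`, `fermionBoxGraph` (`HubbardModel.lean`); `LatticeGaugeDLR.HasFreeEnergyDensity`
(classical gauge theory, other objects). No Hubbard free-energy density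
(`lean search 'freeEnergy' --decl`: only the gauge-theory one).

## References

* D. Ueltschi, J. Stat. Phys. 95 (1999) 693–717, arXiv:cond-mat/9810320, Thm 2.1, Thm 3.1, §§1–3.
* N. Datta, R. Fernández, J. Fröhlich, J. Stat. Phys. 96 (1999) 545–611, arXiv:math-ph/9809007,
  §1.2, §3, §4.
* H. Tasaki, J. Phys.: Condens. Matter 10 (1998) 4353–4378, arXiv:cond-mat/9512169, §5.1–5.2.
* D. Arovas, E. Berg, S. Kivelson, S. Raghu, Annu. Rev. CMP 13 (2022) 239–274, §5.2, §5.4.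
-/

noncomputable section

namespace Literature.Barriers.HubbardSuperconductivity

open Filter Topology Literature.MathematicalPhysics.QuantumLattice

/-- The finite-volume grand-canonical free energy density of the Hubbard model on the box
`Λ_L = {-L,…,L}² ⊂ ℤ²` with free boundary conditions,
`f_L(t, U, μ, β) = -(β |Λ_L|)⁻¹ log tr exp(-β (H_{Λ_L}(t, U) - μ N))`, built from the tree's
`hamiltonianWith (fermionBoxGraph 2 L) t U μ` and `Matrix.partitionFn`. The trace is real and
positive given hermiticity of the Hamiltonian (tree fact
`Literature.MathematicalPhysics.QuantumLattice.hamiltonianWith_isHermitian_and_commute` with `Matrix.partitionFn_pos`); `.re` and `Real.log` act as junk-guards, and the value at `β = 0` is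
the junk value `0` (the barrier only uses `β > 0`). [cite: Ueltschi1999, §2.1–§2.2 and §3 eq. (3.1)] -/
def boxFreeEnergy (t U μ β : ℝ) (L : ℕ) : ℝ :=
  -(β * Fintype.card (FermionBox 2 L))⁻¹ *
    Real.log ((hamiltonianWith (fermionBoxGraph 2 L) t U μ).partitionFn β).re

/-- The infinite-volume free energy density `f(t, U, μ, β) = lim_{L → ∞} f_L` along the boxes
`{-L,…,L}²` (a van Hove sequence); Mathlib's `limUnder`, i.e. a junk value when the limit does
not exist (the barrier fact asserts existence on its domain). [cite: Ueltschi1999, Theorem 2.1 (i)] -/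
def freeEnergy (t U μ β : ℝ) : ℝ :=
  limUnder atTop fun L : ℕ => boxFreeEnergy t U μ β L

/-- **BARRIER `StrongCouplingCeiling` (Ueltschi 1999, Theorem 3.1 with Theorem 2.1 (i), on `D₁`, square lattice).**
There is `ε > 0` (depending only on the lattice `ℤ²`; Ueltschi gives it explicitly through the
maximal coordination number) such that for all hopping `t ≥ 0`, repulsion `U ≥ 0`, chemical
potential `μ` and inverse temperature `β > 0` with `β t < ε`: the free energy density has a
thermodynamic limit along `{-L,…,L}²` and the limit is (jointly) real-analytic in `(β, μ)` —
uniformly in `U`, "however strong is the repulsive potential". In the same domain the Gibbs state is unique,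
exponentially clustering and stable against `U(1)`-breaking boundary terms (Thm 3.1 with Thm 2.1
(ii)–(v); not restated here), so that no superconducting or magnetic order occurs there.

technique_class: strong-coupling-expansion high-temperature-expansion cluster-expansion polymer-expansion quantum-Pirogov-Sinai contour-expansion t-over-U-expansion effective-Hamiltonian
blocks: reaching the ordered low-temperature regime `βt ≳ 1` — a fortiori the ground states in which HubbardSuperconductivity is posed — of the `SU(2)`-symmetric Hubbard model from the atomic limit `t = 0` / high temperature by convergent expansions: the proven domains are `D₁ = {βt < ε}` (uniformly in `U`, `μ`) and `D₂ = {βt²/Δ small}`, `Δ = min(μ, U-μ)`, inside which the state is unique and clustering, so "interesting phenomena are definitively excluded" there [cite: Ueltschi1999, Theorem 3.1 and §1]; low-temperature contour/Pirogov–Sinai technology built on the convergent `t/U` effective Hamiltonians "is not suited for the study of the phase diagram of the SU(2)-symmetric Hubbard model" [cite: DattaFernandezFrohlich1999, §1.2 pp. 6–7 and §4 p. 21].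
because: at `t = 0` the ground states are all spin configurations of singly occupied sites — "infinitely degenerate" [cite: DattaFernandezFrohlich1999, §1.2 p. 5] [cite: Tasaki1998, §5.1]; hopping lifts this only at order `t²/U`, into the `S = 1/2` Heisenberg antiferromagnet / `t`-`J` interaction [cite: Tasaki1998, §5.1 eq. (5.2)] [cite: DattaFernandezFrohlich1999, §1.2 (I) and §3] [cite: Ueltschi1999, §1], whose ordering is itself unproved by these means ("no methods or ideas which are useful in proving the conjecture") [cite: Tasaki1998, §5.2]; "when there is a continuous symmetry, states are usually grouped in bands with gapless intraband excitations … no such treatment is available for the (symmetric) Hubbard model" — the gapped, finitely degenerate reference state required by quantum Pirogov–Sinai theory is absent [cite: DattaFernandezFrohlich1999, §4 p. 21 and §1.2 p. 7]; and since very large `U` is (Nagaoka) ferromagnetic, "the non-ferromagnetic states generally seen (and expected) at intermediate values of U cannot be approached from a strong-coupling perspective" [cite: ArovasBergKivelsonRaghu2022, §5.2 p. 17].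
evasions_known: spin-asymmetric hopping `|t₊| ≪ |t₋|` (Falicov–Kimball regime and its perturbations): ground states and low-temperature phases by Kennedy–Lieb-type arguments and quantum Pirogov–Sinai [cite: DattaFernandezFrohlich1999, §1.2 (II) and §3 p. 18] [cite: Ueltschi1999, §3] — a different model; large-`N` generalisations "that allow controlled access to a variety of intermediate-coupling spin and charge ordered phases" [cite: ArovasBergKivelsonRaghu2022, §5.4 p. 18] — different models; none published for `t₊ = t₋` at `βt ≳ 1`.
scope_caveats: the THEOREM content is positive — analyticity, uniqueness and clustering INSIDE `D₁ ∪ D₂` [cite: Ueltschi1999, Theorem 3.1]; no source prints a theorem that an expansion around `t = 0` cannot converge at `βt ≳ 1`: "not suited" / "no such treatment is available" are statements about the quantum Pirogov–Sinai method, whose hypotheses (finitely many gapped ground states) fail for the `SU(2)`-symmetric model [cite: DattaFernandezFrohlich1999, §1.2 p. 7 and §4 p. 21], and "seems hopeless" is an assessment [cite: Tasaki1998, §5.2]; the ferromagnetism invoked in [cite: ArovasBergKivelsonRaghu2022, §5.2 p. 17] is proved only for one hole at `U = ∞` (Nagaoka) — "it is still not known if such extensions [finite `U`, finite hole density] are possible"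 [cite: Tasaki1998, §6.3, Theorem 6.3 and p. 21]; only Thm 3.1 with Thm 2.1 (i) on `D₁` for the square lattice with free boundary conditions is transcribed in Lean — joint analyticity in `(β, μ)`; analyticity in `t`, Thm 2.1 parts (ii)–(v), the domain `D₂`, other lattices and Ueltschi's explicit `ε` are cited, not restated; the hypothesis `0 ≤ U` is an unused specialisation (Thm 2.1's domain is independent of the on-site `V`) [cite: Ueltschi1999, Theorem 2.1] — and the summit is posed on tori in the canonical ensemble, to which Thm 3.1 is not literally addressed; (AUDIT 2026-08-15, refuter barrier-audit — NARROWED, corrected record `StrongCouplingCeilingNarrow` below): the `technique_class:` tokens `t-over-U-expansion effective-Hamiltonian` and the `blocks:` frontier "`βt ≳ 1`" over-reach what the sources print — the convergent `t/U` perturbation technique (I) "is applicable in such situations" (rigorous `t`-`J` + three-site effective interaction with controlled remainders, also in the doped window near `μ = 0`) and only the contour / quantum Pirogov–Sinai phase-diagram step is obstructed [cite: DattaFernandezFrohlich1999, §1.2 p. 7 and p. 6]; the printed analyticity/uniqueness region already contains points with `βt` arbitrarily large (`D₂`: half filling above the exchange scale; `StrongCouplingCeilingNarrow.exists_large_beta_t`)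 [cite: Ueltschi1999, Theorem 3.1] [cite: FrohlichReybelletUeltschi2001, §4.4 Remark 2], reaches low temperatures and ground states in the band-insulator windows `μ < 0`, `μ > U` [cite: DattaFernandezFrohlich1999, §1.2 (R3) p. 6 and §5.1 p. 27], and is expected by the source to extend to "possibly" every `β < ∞` in `d = 2` [cite: Ueltschi1999, §3 (remark after Theorem 3.1)]; what remains blocked is the window of chemical potentials with infinitely degenerate atomic-limit ground states (which contains every doping `δ ∈ (0, 1/2)` of the summit) below the exchange / hopping temperature scales — see the narrowed record.
status: established (Ueltschi Thm 3.1 is a theorem [cite: Ueltschi1999, Theorem 3.1]; that no convergent expansion around `t = 0` reaches the symmetric model's low-temperature phases is folklore, printed as method limitation in [cite: DattaFernandezFrohlich1999, §4 p. 21] and [cite: Tasaki1998, §5.2]); audited 2026-08-15 (NARROWED — corrected record `StrongCouplingCeilingNarrow`, same file; the Lean statement below is unchanged and is proved in `StrongCouplingCeilingProofs`)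
[cite: Ueltschi1999, Theorem 3.1 (domain D₁) with Theorem 2.1 (i)] -/
def StrongCouplingCeiling : Prop :=
  ∃ ε : ℝ, 0 < ε ∧ ∀ (t U μ β : ℝ), 0 ≤ t → 0 ≤ U → 0 < β → β * t < ε →
    Tendsto (fun L : ℕ => boxFreeEnergy t U μ β L) atTop (𝓝 (freeEnergy t U μ β)) ∧
      AnalyticAt ℝ (fun p : ℝ × ℝ => freeEnergy t U p.2 p.1) (β, μ)

/-- Unfolding lemma for `boxFreeEnergy`. [cite: Ueltschi1999, §2.2] -/
theorem boxFreeEnergy_def (t U μ β : ℝ) (L : ℕ) :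
    boxFreeEnergy t U μ β L =
      -(β * Fintype.card (FermionBox 2 L))⁻¹ *
        Real.log ((hamiltonianWith (fermionBoxGraph 2 L) t U μ).partitionFn β).re :=
  rfl

/-- The box `{-L,…,L}²` has `(2L+1)²` sites (so the normalisation `|Λ_L|⁻¹` above is never a
division by zero). [folklore] -/
theorem card_fermionBox_two (L : ℕ) : Fintype.card (FermionBox 2 L) = (2 * L + 1) ^ 2 := by
  simp [FermionBox, Lex, Fintype.card_fin]

/-- If the barrier fact holds, the thermodynamic limit of the free energy exists at every point
of `D₁` (the existence half of Thm 3.1/Thm 2.1 (i), separated for users). [cite: Ueltschi1999, Theorem 3.1] -/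
theorem StrongCouplingCeiling.tendsto (h : StrongCouplingCeiling) :
    ∃ ε : ℝ, 0 < ε ∧ ∀ (t U μ β : ℝ), 0 ≤ t → 0 ≤ U → 0 < β → β * t < ε →
      Tendsto (fun L : ℕ => boxFreeEnergy t U μ β L) atTop (𝓝 (freeEnergy t U μ β)) := by
  obtain ⟨ε, hε, H⟩ := h
  exact ⟨ε, hε, fun t U μ β ht hU hβ hβt => (H t U μ β ht hU hβ hβt).1⟩

/-- Joint analyticity gives in particular analyticity in `β` at fixed `μ` (composition with the
analytic map `β' ↦ (β', μ)`); similarly in `μ` at fixed `β`. [cite: Ueltschi1999, Theorem 3.1] -/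
theorem StrongCouplingCeiling.analyticAt_beta (h : StrongCouplingCeiling) :
    ∃ ε : ℝ, 0 < ε ∧ ∀ (t U μ β : ℝ), 0 ≤ t → 0 ≤ U → 0 < β → β * t < ε →
      AnalyticAt ℝ (fun β' : ℝ => freeEnergy t U μ β') β := by
  obtain ⟨ε, hε, H⟩ := h
  refine ⟨ε, hε, fun t U μ β ht hU hβ hβt => ?_⟩
  have hA : AnalyticAt ℝ (fun p : ℝ × ℝ => freeEnergy t U p.2 p.1) (β, μ) :=
    (H t U μ β ht hU hβ hβt).2
  exact hA.curry_left

/-! ### Audit 2026-08-15 (refuter barrier-audit, D-0021): the narrowed record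

The sources print (1) a POSITIVE theorem on `D₁ ∪ D₂`, where `D₂` already reaches arbitrarily
large `βt` at half filling above the exchange scale, (2) low-temperature control wherever the
atomic-limit ground state is unique, and (3) a declared limitation of the quantum Pirogov–Sinai
step — while the convergent `t/U` effective-Hamiltonian expansion itself is declared applicable.
The record below restates the barrier with that scope; its kernel is Ueltschi's Theorem 3.1 on
both domains. -/

/-- **BARRIER `StrongCouplingCeilingNarrow` (audit 2026-08-15; supersedes the `technique_class:`
and `blocks:` lines of `StrongCouplingCeiling`).**

Formal kernel (this `Prop`; Ueltschi's Theorem 3.1 on BOTH printed domains, constants not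
transcribed): there are `ε > 0` and `c > 0` (in the source `ε = (2χℶe^φφ²)⁻¹` and `c = 2χε²`,
`χ = 4` the maximal coordination number of `ℤ²`) such that for all `t ≥ 0`, all real `U`, `μ` and
all `β > 0` with EITHER `βt < ε` (`D₁`; no condition on `U`, `μ` — the domain of Theorem 2.1
"does not depend on the local interaction `V`") OR `0 < μ < U`, `2t < εΔ` and
`βt² < c (Δ - 2t/ε)` with `Δ = min(μ, U - μ)` (`D₂`, i.e. `βt²/Δ < 2χε²(1 - 2t/(εΔ))`, "meaningful
only if `t/Δ < ε/2`"), the free energy density has a thermodynamic limit along `{-L,…,L}²` and the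
limit is jointly real-analytic in `(β, μ)`. For every `M` the clause `D₂` admits parameters with
`βt > M` (`StrongCouplingCeilingNarrow.exists_large_beta_t`, proved below): the printed
analyticity/uniqueness region is not bounded by the hopping temperature scale. The kernel implies
the old one (`StrongCouplingCeilingNarrow.strongCouplingCeiling`); its `D₁` half is the tree
theorem `StrongCouplingCeiling_holds` (file `StrongCouplingCeilingProofs`, whose proof discards the
hypothesis `0 ≤ U`); the whole kernel, `D₂` half included, is the tree theorem
`StrongCouplingCeilingNarrow_holds` (file `StrongCouplingCeilingNarrowProofs`, 2026-08-15: Ueltschi's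
space–time loop bound replaced by a comparison-semigroup / Lyapunov-vector bound on the same polymer
weights, `HubbardGapBounds`, same domain shape `t/Δ`, `βt²/Δ` small).

BARRIER
technique_class: high-temperature-expansion cluster-expansion polymer-expansion (convergent expansions of `e^{-βH_Λ}` in the hopping around the atomic limit `t = 0`, Duhamel / polymer / space–time loop form) quantum-Pirogov-Sinai contour-expansion restricted-ensemble (low-temperature stability of finitely many gapped periodic ground states, or of a spatially ordered family of configurations, of the classical part) — and NOT the convergent `t/U` unitary-conjugation expansion / effective-Hamiltonian derivation as such, which the source declares applicable to the symmetric model [cite: DattaFernandezFrohlich1999, §1.2 p. 7]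
blocks: for the `SU(2)`-symmetric (`t₊ = t₋`) Hubbard model on `ℤ²`: constructing the Gibbs states (uniqueness or coexistence, clustering, order) and a fortiori the ground states by these expansions INSIDE the window of chemical potentials where the atomic-limit ground state is infinitely degenerate — `0 ≤ μ ≤ U` at `t = 0` ("for `0 < μ₊ = μ₋ < U` the ground state is infinitely degenerate, because all singly occupied configurations are equally likely"; the endpoints `μ = 0`, `μ = U` are moreover charge-degenerate: "each site is either empty or singly occupied") [cite: DattaFernandezFrohlich1999, §1.2 p. 5], i.e. at `t > 0` the half-filled Mott window together with the doped windows `|μ| ≲ χt`, `|μ - U| ≲ χt`, in which every hole doping `δ ∈ (0, 1/2)` of `HubbardSuperconductivity` lies — at temperatures below the printed frontier: below the EXCHANGE scale near half filling (`βt²/Δ ≳ 2χε²`, `Δ = min(μ, U - μ) ≫ t`) and below the HOPPING scale (`βt ≥ ε`) in the doped windows. Printed positive domains: `D₁ = {βt < ε}` for all `U`, `μ`, and `D₂ = {0 < μ < U, βt²/Δ < 2χε²(1 - 2t/(εΔ))}` — thermodynamic limit, analytic free energy, unique exponentially clustering Gibbs state stable against boundary fields (including the `U(1)`-breaking ones)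 and perturbations [cite: Ueltschi1999, Theorem 3.1 with Theorem 2.1 (i)–(v) and §2.2]; "the high temperature phase extends to `{βt small}` and `{βt²/U small}`" [cite: FrohlichReybelletUeltschi2001, §4.4 Remark 2]; low temperatures including the ground state wherever the `t = 0` Hamiltonian has a UNIQUE ground state (`μ < 0`: empty band; `μ > U`: full band; hopping small against the gap) — "we apply the cluster expansion … to conclude that the ground state is stable for small hopping amplitudes and at low temperatures" [cite: DattaFernandezFrohlich1999, §1.2 (R3) p. 6 and §5.1 p. 27]. Inside the degenerate window the contour step "will be achieved only for the models without continuous `SU(2)`-symmetry" [cite: DattaFernandezFrohlich1999, §1.2 p. 6] and "we cannot apply our phase-diagram technology to the effective Hamiltonians that would be obtained via Gutzwiller projections (`t`-`J` interaction + higher orders)" [cite: DattaFernandezFrohlich1999, §1.2 p. 7].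
because: in the degenerate window the leading effective interaction delivered by the convergent `t/U` expansion — the `S = 1/2` Heisenberg antiferromagnet at half filling (`Σ_{x,y} J_{x,y}(S_x·S_y - 1/4)` over ordered pairs with `J_{x,y} = t²/U_x + t²/U_y = 2t²/U`) [cite: Tasaki1998, §5.1 eq. (5.2)] [cite: DattaFernandezFrohlich1999, §1.2 (I) p. 5], the `t`-`J` + three-site interaction in the doped window [cite: DattaFernandezFrohlich1999, §1.2 p. 6] — keeps the continuous symmetry: "states are usually grouped in bands with gapless intraband excitations. An arbitrarily small additional term can split the lower bands … no such treatment is available for the (symmetric) Hubbard model, despite our control on the perturbation series" [cite: DattaFernandezFrohlich1999, §4 p. 21], so the gapped, finitely degenerate reference state of quantum Pirogov–Sinai theory is absent — in the effective-potential formulation the exchange of two neighbouring spins costs the same order `t²` as the effective interaction selects ("quantum instability … In the Hubbard model it is a manifestation of a continuous symmetry"; the symmetric model "does not fall into the class of models we can treat") [cite: KoteckyUeltschi1999, §1 p. 3 and §3.1 p. 13] — and its ordering is unproved by any means ("no methods or ideas which are useful in proving the conjecture") [cite: Tasaki1998, §5.2]; in the doped window the hopping acts at FIRST order inside the degenerate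 manifold (constrained hopping of holes is the leading dynamics, with no small parameter left once double occupancy is projected out), so the only printed handle there is the high-temperature condition `βt < ε` [cite: Ueltschi1999, Theorem 3.1]; near half filling the handle is `βt²/Δ` small, "qualitatively correct" as the boundary of an antiferromagnetic phase expected for `ν ≥ 3` at `βt²/U > const` [cite: Ueltschi1999, §3 (remark after Theorem 3.1)] [cite: FrohlichReybelletUeltschi2001, §5 (after Theorem 5.2)].
evasions_known: (a) NOT blocked and available as rigorous input: the convergent `t/U` effective Hamiltonians, equivalent to the model by a unitary conjugation and block-diagonal to any finite order `tⁿ/Uⁿ⁻¹` with controlled remainders — "we emphasize that the perturbation technique (I) is applicable in such situations" [cite: DattaFernandezFrohlich1999, §1.2 p. 7 and (R1)–(R2) p. 5]; what is missing is any rigorous analysis of the resulting `t`-`J` / Heisenberg problem, not the derivation; (b) temperatures above the exchange scale at arbitrarily large `βt` near half filling: `D₂` [cite: Ueltschi1999, Theorem 3.1] [cite: FrohlichReybelletUeltschi2001, §4.4 Remark 2] (kernel clause `D₂`; `exists_large_beta_t`); (c) the band-insulator windows `μ < 0`, `μ > U` down to the ground state [cite: DattaFernandezFrohlich1996, via DattaFernandezFrohlich1999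 §1.2 (R3) p. 6]; uniform-in-temperature clustering for on-site Hamiltonians with a unique gapped ground state under relatively form-bounded perturbations (quantum spin systems) [cite: AdhikariEtAl2025, §1.1 and Theorem 2.2] — densities `0` and `2`, outside the summit's window; (d) the DILUTE corner at `T = 0` for every `U ∈ [0, ∞]`, by a low-density rather than small-`t` expansion: ground-state energy of the Hubbard model on `ℤ³` to second order, `e₀(ρ↑, ρ↓) + 8πaρ↑ρ↓`, "valid for any repulsion strength `U ≥ 0`, including the limiting case `U = +∞`", with `S/S_max → 0` as `ρ → 0` [cite: Giuliani2007, Theorem 1, Remark 1 and Corollary 1] [cite: SeiringerYin2008, Theorem 1] — energy asymptotics only, printed for `ℤ³`, electron density `→ 0` (doping `δ → 1`), outside the summit's window `δ ∈ (0, 1/2)`; (e) spin-asymmetric hopping `|t₊| ≪ |t₋|` and other models whose effective interaction has finitely many gapped ground states: low-temperature phases by quantum Pirogov–Sinai [cite: DattaFernandezFrohlich1999, §1.2 (II) (R4) p. 6] [cite: FrohlichReybelletUeltschi2001, §1 Example 1] — different models; (f) `d = 2`, `T > 0`: "These properties likely hold for all `β < ∞` in dimension 1, and possibly also in dimension 2"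 [cite: Ueltschi1999, §3 (remark after Theorem 3.1)] — no printed obstruction to extending the unique analytic phase to every finite `β` in two dimensions (pair long-range order at `T > 0` being excluded there anyway, catalogue entry `HohenbergMerminWagnerPairing`), so for the summit the record constrains only approaches to the GROUND states through such expansions; none of (a)–(f) produces a state in the doped window at `βt ≥ ε`.
scope_caveats: (a) no impossibility theorem is printed: every cited statement is a positive theorem (on `D₁ ∪ D₂`, on the uniqueness regions) or a declared limitation of the quantum Pirogov–Sinai method [cite: DattaFernandezFrohlich1999, §1.2 p. 7 and §4 p. 21]; a convergent expansion organised differently inside the degenerate window would evade, not contradict, this record; (b) the kernel transcribes Theorem 3.1 for `ℤ²` (the source works on a general lattice with maximal coordination number `χ`, explicit constants for `ν = 3`), free boundary conditions, grand-canonical ensemble, joint real-analyticity in `(β, μ)` with existential constants; the Gibbs-state clauses (ii)–(v) are cited only [cite: Ueltschi1999, Theorem 3.1 and Theorem 2.1]; the summit is posed on even tori in the canonical ensemble at `T = 0`; (c) both halves of the kernel are proved in the tree (`StrongCouplingCeilingNarrow_holds`; the `D₁` half alone is `StrongCouplingCeiling_holds`), with existential, non-optimised constants; (d) the dilute-corner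 theorems of (d) above are printed for the simple cubic lattice `ℤ³`; "the method can be used in more general cases. For instance, different lattice structures" [cite: SeiringerYin2008, §1 (after Theorem 1)] — no `ℤ²` statement is printed there; (e) this audit's searches ran with the hub full-text index unavailable (searchd rc 75) and OpenAlex / Semantic Scholar rate-limited; zbMATH, the local citation frontier, the internal galaxy corpus and the held texts [cite: Ueltschi1999, Theorem 3.1] [cite: DattaFernandezFrohlich1999, §1.2] [cite: FrohlichReybelletUeltschi2001, §4.4 Remark 2] were read at page level.
status: established (kernel = [cite: Ueltschi1999, Theorem 3.1], proved in the tree as `StrongCouplingCeilingNarrow_holds`); supersedes the `technique_class:` and `blocks:` lines of `StrongCouplingCeiling` (audit 2026-08-15)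
[cite: Ueltschi1999, Theorem 3.1 (domains D₁ and D₂) with Theorem 2.1 (i)] -/
def StrongCouplingCeilingNarrow : Prop :=
  ∃ ε : ℝ, 0 < ε ∧ ∃ c : ℝ, 0 < c ∧ ∀ (t U μ β : ℝ), 0 ≤ t → 0 < β →
    (β * t < ε ∨
      (0 < μ ∧ μ < U ∧ 2 * t < ε * min μ (U - μ) ∧
        β * t ^ 2 < c * (min μ (U - μ) - 2 * t / ε))) →
    Tendsto (fun L : ℕ => boxFreeEnergy t U μ β L) atTop (𝓝 (freeEnergy t U μ β)) ∧
      AnalyticAt ℝ (fun p : ℝ × ℝ => freeEnergy t U p.2 p.1) (β, μ)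

/-- The narrowed kernel implies the original one: take the branch `D₁` (the hypothesis `0 ≤ U` of
`StrongCouplingCeiling` is not needed). [cite: Ueltschi1999, Theorem 3.1 (domain D₁)] -/
theorem StrongCouplingCeilingNarrow.strongCouplingCeiling (h : StrongCouplingCeilingNarrow) :
    StrongCouplingCeiling := by
  obtain ⟨ε, hε, _, _, H⟩ := h
  exact ⟨ε, hε, fun t U μ β ht _ hβ hβt => H t U μ β ht hβ (Or.inl hβt)⟩

/-- The clause `D₂` is not bounded by the hopping temperature scale: for all `ε, c > 0` and every
`M` there are parameters satisfying it with `βt > M` (`μ = 1`, `U = 2`, so `Δ = 1`;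
`t = min(ε/4, c/(8M'))`, `β = 2M'/t`, `M' = max(M, 1)`). [cite: Ueltschi1999, Theorem 3.1 (domain D₂) and §3 (remark after Theorem 3.1)] -/
theorem StrongCouplingCeilingNarrow.exists_large_beta_t (ε c M : ℝ) (hε : 0 < ε) (hc : 0 < c) :
    ∃ t U μ β : ℝ, 0 < t ∧ 0 < β ∧ 0 < μ ∧ μ < U ∧ 2 * t < ε * min μ (U - μ) ∧
      β * t ^ 2 < c * (min μ (U - μ) - 2 * t / ε) ∧ M < β * t := by
  set M' : ℝ := max M 1 with hM'
  have hM'1 : 1 ≤ M' := le_max_right _ _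
  have hM'pos : 0 < M' := lt_of_lt_of_le one_pos hM'1
  have hMM' : M ≤ M' := le_max_left _ _
  set t : ℝ := min (ε / 4) (c / (8 * M')) with ht
  have htε : t ≤ ε / 4 := min_le_left _ _
  have htc : t ≤ c / (8 * M') := min_le_right _ _
  have htpos : 0 < t := lt_min (by positivity) (by positivity)
  refine ⟨t, 2, 1, 2 * M' / t, htpos, by positivity, one_pos, by norm_num, ?_, ?_, ?_⟩
  · have hmin : min (1 : ℝ) (2 - 1) = 1 := by norm_num
    rw [hmin]
    linarith
  · have hmin : min (1 : ℝ) (2 - 1) = 1 := by norm_num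
    rw [hmin]
    have h1 : 2 * M' / t * t ^ 2 = 2 * M' * t := by
      field_simp
    rw [h1]
    have h2 : 2 * M' * t ≤ c / 4 := by
      have := mul_le_mul_of_nonneg_left htc (by positivity : (0 : ℝ) ≤ 2 * M')
      calc 2 * M' * t ≤ 2 * M' * (c / (8 * M')) := this
        _ = c / 4 := by field_simp; ring
    have h3 : 2 * t / ε ≤ 1 / 2 := by
      rw [div_le_iff₀ hε]
      linarith
    nlinarith
  · have h1 : 2 * M' / t * t = 2 * M' := by field_simp
    rw [h1]
    linarith


end Literature.Barriers.HubbardSuperconductivity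

end
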